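import Literature.Probability.RandomPlanarGeometry.SAWStripTMDecode
import HarnessLib

/-!
# Traces of the strip transfer matrix: runs, acceptance, decoding (soundness, part 13)

Topic `Literature/Probability/RandomPlanarGeometry` (soundness of `SAWStripTM.lean`, part 13).
A **trace** is the list of Boolean choices read by the micro-steps. `runT` runs the signature
automaton, `runG` runs it together with the ghost strand family; a trace is **accepted** when all
its steps but the last continue the run and the last one completes it. `decode cs` is the step
word of the final strand. Main results:

* `decode_spec` — the decoded word of an accepted trace is an irreducible bridge of span `l`,
  of length at most (number of chosen edges) `+ 1`;
* `decode_inj` — decoding is injective on accepted traces.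

## References

* I. Jensen, J. Phys. A 37 (2004) 11521–11529, §2.1.
* H. Kesten, J. Math. Phys. 4 (1963) 960–969, §4.
-/

open Finset

namespace Literature.Probability.RandomPlanarGeometry.SAW

namespace StripTM

variable (l r0 : ℕ)

/-! ### Runs -/

/-- Run of the signature automaton from micro-time `u` and signature `σ` (`none` as soon as a
step does not continue). [cite: Jensen2004SAWLowerBounds, §2.1] -/
def runT : ℕ → State → List Bool → Option State
  | _, σ, [] => some σ
  | u, σ, e :: cs =>
    match step l r0 u σ e with
    | .next σ' => runT (u + 1) σ' cs
    | _ => none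

/-- Run of the signature automaton together with the ghost family. [folklore] -/
def runG : ℕ → State → List (List XCell) → List Bool → Option (State × List (List XCell))
  | _, σ, S, [] => some (σ, S)
  | u, σ, S, e :: cs =>
    match step l r0 u σ e with
    | .next σ' => runG (u + 1) σ' (gstep l r0 u σ S e) cs
    | _ => none

/-- **Accepted traces**: all steps but the last continue the run, the last completes it.
[cite: Jensen2004SAWLowerBounds, §2.1] -/
def Accepts (cs : List Bool) : Prop :=
  ∃ init : List Bool, ∃ e : Bool, ∃ σ : State, cs = init ++ [e] ∧
    runT l r0 0 (initState l) init = some σ ∧ step l r0 init.length σ e = .complete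

/-- Number of edges chosen by a trace among its first `n` letters. [folklore] -/
def edgesN (cs : List Bool) (n : ℕ) : ℕ := ((Finset.range n).filter fun u' => cs.getD u' false = true).card

/-- **Decoding**: the step word of the final strand of the run. [cite: Jensen2004SAWLowerBounds, §2.1] -/
noncomputable def decode (cs : List Bool) : List Step :=
  match runG l r0 0 (initState l) [] cs.dropLast with
  | some p => stepsOf r0 (finalStrand (gstep l r0 (cs.length - 1) p.1 p.2 (cs.getD (cs.length - 1) false))).dropLast
  | none => []

variable {l r0}

/-- `runT` on an append. [folklore] -/
theorem runT_append (u : ℕ) (σ : State) (xs ys : List Bool) :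
    runT l r0 u σ (xs ++ ys) = (runT l r0 u σ xs).bind fun σ' => runT l r0 (u + xs.length) σ' ys := by
  induction xs generalizing u σ with
  | nil => simp [runT]
  | cons e xs ih =>
    cases hs : step l r0 u σ e with
    | next σ' =>
      simp only [List.cons_append, runT, hs, List.length_cons]
      rw [ih, show u + 1 + xs.length = u + (xs.length + 1) by omega]
    | dead => simp only [List.cons_append, runT, hs]; rfl
    | complete => simp only [List.cons_append, runT, hs]; rfl

/-- `runG` on an append. [folklore] -/
theorem runG_append (u : ℕ) (σ : State) (S : List (List XCell)) (xs ys : List Bool) :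
    runG l r0 u σ S (xs ++ ys) = (runG l r0 u σ S xs).bind fun p => runG l r0 (u + xs.length) p.1 p.2 ys := by
  induction xs generalizing u σ S with
  | nil => simp [runG]
  | cons e xs ih =>
    cases hs : step l r0 u σ e with
    | next σ' =>
      simp only [List.cons_append, runG, hs, List.length_cons]
      rw [ih, show u + 1 + xs.length = u + (xs.length + 1) by omega]
    | dead => simp only [List.cons_append, runG, hs]; rfl
    | complete => simp only [List.cons_append, runG, hs]; rfl

/-- The signature component of `runG` is `runT`. [folklore] -/
theorem runG_fst (u : ℕ) (σ : State) (S : List (List XCell)) (cs : List Bool) :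
    (runG l r0 u σ S cs).map Prod.fst = runT l r0 u σ cs := by
  induction cs generalizing u σ S with
  | nil => rfl
  | cons e cs ih =>
    cases hs : step l r0 u σ e with
    | next σ' => simp only [runG, runT, hs]; exact ih _ _ _
    | dead => simp only [runG, runT, hs]; rfl
    | complete => simp only [runG, runT, hs]; rfl

/-- **The invariant along a run.** [cite: Jensen2004SAWLowerBounds, §2.1] -/
theorem inv_runG (hl : 2 ≤ l) {cs : List Bool} (init : List Bool)
    (hcs : ∀ u < init.length, init.getD u false = cs.getD u false) {σ : State} {S : List (List XCell)}
    (h : runG l r0 0 (initState l) [] init = some (σ, S)) : Inv l r0 cs init.length σ S := by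
  induction init using List.reverseRecOn generalizing σ S with
  | nil =>
    simp only [runG, Option.some.injEq, Prod.mk.injEq] at h
    obtain ⟨rfl, rfl⟩ := h
    exact inv_init cs (by omega)
  | append_singleton init e ih =>
    rw [runG_append] at h
    cases hr : runG l r0 0 (initState l) [] init with
    | none => rw [hr] at h; simp at h
    | some p =>
      rw [hr, Option.bind_some] at h
      obtain ⟨σ₁, S₁⟩ := p
      simp only [zero_add, runG] at h
      have hI := ih (fun u hu => by
        rw [← hcs u (by simp; omega), List.getD_eq_getElem?_getD, List.getD_eq_getElem?_getD,
          List.getElem?_append_left hu]) hr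
      have he : e = cs.getD init.length false := by
        have := hcs init.length (by simp)
        rw [List.getD_eq_getElem?_getD, List.getElem?_append_right le_rfl] at this
        simpa using this
      rw [he] at h
      cases hs : step l r0 init.length σ₁ (cs.getD init.length false) with
      | next σ' =>
        rw [hs] at h
        simp only [Option.some.injEq, Prod.mk.injEq] at h
        obtain ⟨rfl, rfl⟩ := h
        rw [List.length_append, List.length_singleton]
        exact inv_step hl hI hs
      | dead => rw [hs] at h; simp at h
      | complete => rw [hs] at h; simp at h

/-! ### Injectivity of the edge labelling -/

/-- The cell of a cell-time is determined by it. [folklore] -/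
theorem cellOf_inj {t₁ t₂ : ℕ} (h : cellOf l t₁ = cellOf l t₂) : t₁ = t₂ := by
  simp only [cellOf, XCell.cell.injEq] at h
  have h1 := Nat.div_add_mod t₁ l; have h2 := Nat.div_add_mod t₂ l
  rw [h.1, show t₁ / l = t₂ / l by omega] at h1; omega

/-- **`potEdge` is injective.** [folklore] -/
theorem potEdge_inj {u₁ u₂ : ℕ} (h : potEdge l u₁ = potEdge l u₂) : u₁ = u₂ := by
  have key : u₁ / 2 = u₂ / 2 ∧ u₁ % 2 = u₂ % 2 := by
    rcases Nat.mod_two_eq_zero_or_one u₁ with h₁ | h₁ <;> rcases Nat.mod_two_eq_zero_or_one u₂ with h₂ | h₂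
    · rw [potEdge_of_even h₁, potEdge_of_even h₂, Sym2.eq_iff] at h
      rcases h with ⟨-, h⟩ | ⟨ha, hb⟩
      · exact ⟨cellOf_inj h, by rw [h₁, h₂]⟩
      · simp only [below, cellOf, XCell.cell.injEq] at ha hb; omega
    · rw [potEdge_of_even h₁, potEdge_of_odd h₂, Sym2.eq_iff] at h
      rcases h with ⟨ha, hb⟩ | ⟨ha, hb⟩
      · have ht := cellOf_inj hb; rw [ht] at ha; simp only [below, leftOf, XCell.cell.injEq] at ha; omega
      · simp only [below, cellOf, leftOf, XCell.cell.injEq] at ha hb; omega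
    · rw [potEdge_of_odd h₁, potEdge_of_even h₂, Sym2.eq_iff] at h
      rcases h with ⟨ha, hb⟩ | ⟨ha, hb⟩
      · have ht := cellOf_inj hb; rw [ht] at ha; simp only [below, leftOf, XCell.cell.injEq] at ha; omega
      · simp only [below, cellOf, leftOf, XCell.cell.injEq] at ha hb; omega
    · rw [potEdge_of_odd h₁, potEdge_of_odd h₂, Sym2.eq_iff] at h
      rcases h with ⟨-, h⟩ | ⟨ha, hb⟩
      · exact ⟨cellOf_inj h, by rw [h₁, h₂]⟩
      · simp only [cellOf, leftOf, XCell.cell.injEq] at ha hb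
        refine ⟨cellOf_inj (l := l) ?_, by rw [h₁, h₂]⟩
        simp only [cellOf, XCell.cell.injEq]; omega
  omega

/-- The odd edge of a column is horizontal at that column. [folklore] -/
theorem horiz_potEdge {u : ℕ} (hu : u % 2 = 1) : Horiz (u / 2 % l) (potEdge l u) :=
  ⟨u / 2 / l + 1, by rw [potEdge_of_odd hu]; rfl⟩

/-- Two witnesses from a filter of length `≥ 2`. [folklore] -/
theorem exists_two_of_le_length_filter {N : ℕ} {q : ℕ → Bool} (h : 2 ≤ ((List.range N).filter q).length) :
    ∃ i₁ i₂, i₁ ≠ i₂ ∧ i₁ < N ∧ i₂ < N ∧ q i₁ = true ∧ q i₂ = true := by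
  set F := (List.range N).filter q with hF
  have hnd : F.Nodup := List.nodup_range.filter _
  have hmem : ∀ x ∈ F, x < N ∧ q x = true := fun x hx => by
    rw [hF, List.mem_filter, List.mem_range] at hx; exact hx
  match hF' : F, h, hnd with
  | a :: b :: t, _, hnd =>
    refine ⟨a, b, ?_, (hmem a (by simp)).1, (hmem b (by simp)).1,
      (hmem a (by simp)).2, (hmem b (by simp)).2⟩
    intro e; subst e; simp at hnd

/-! ### The decoded word -/

/-- **The decoded word of an accepted trace is an irreducible bridge of span `l`, of length at
most the number of chosen edges plus one.** [cite: Jensen2004SAWLowerBounds, §2.1] -/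
theorem decode_spec (hl : 2 ≤ l) {cs : List Bool} (hacc : Accepts l r0 cs) :
    IsIrrBridge (decode l r0 cs) ∧ xEnd (decode l r0 cs) = l ∧
      (decode l r0 cs).length ≤ edgesN cs cs.length + 1 := by
  have hl0 : 0 < l := by omega
  obtain ⟨init, e, σ, rfl, hrun, hstep⟩ := hacc
  -- the ghost run
  have hG : ∃ S, runG l r0 0 (initState l) [] init = some (σ, S) := by
    have := runG_fst (l := l) (r0 := r0) 0 (initState l) [] init
    rw [hrun] at this
    cases hr : runG l r0 0 (initState l) [] init with
    | none => rw [hr] at this; simp at this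
    | some p => rw [hr] at this; simp only [Option.map_some, Option.some.injEq] at this
                exact ⟨p.2, by rw [← this]⟩
  obtain ⟨S, hrunG⟩ := hG
  set cs := init ++ [e] with hcs_def
  have hI : Inv l r0 cs init.length σ S := inv_runG hl init (fun u hu => by
    rw [hcs_def, List.getD_eq_getElem?_getD, List.getD_eq_getElem?_getD, List.getElem?_append_left hu]) hrunG
  have he : cs.getD init.length false = e := by
    rw [hcs_def, List.getD_eq_getElem?_getD, List.getElem?_append_right le_rfl]; simp
  have hF := final_step hl hI (by rw [he]; exact hstep)
  set ν := finalStrand (gstep l r0 init.length σ S (cs.getD init.length false)) with hν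
  obtain ⟨eν, hGL⟩ := hF.goodL
  have hdec : decode l r0 cs = stepsOf r0 ν.dropLast := by
    rw [decode, hcs_def, List.dropLast_concat, hrunG]
    simp only [List.length_append, List.length_singleton, Nat.add_sub_cancel, hν, hcs_def]
  rw [hdec]
  have hlenν := hGL.two_le
  obtain ⟨hbr, hend⟩ := hGL.isBridgeW
  refine ⟨⟨hGL.isSAW, hbr, ?_, ?_⟩, hend, ?_⟩
  · -- irreducible: every internal gap is crossed at least twice
    refine isIrreducible_of_crossings hbr fun h h1 h2 => ?_
    rw [hend] at h2
    obtain ⟨k, rfl⟩ : ∃ k : ℕ, h = (k : ℤ) := ⟨h.toNat, by omega⟩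
    have hk1 : 1 ≤ k := by exact_mod_cast h1
    have hkl : k < l := by exact_mod_cast h2
    have hgap := hF.gaps (k - 1) (by omega)
    rw [show k - 1 + 1 = k by omega, hcount] at hgap
    obtain ⟨u₁, u₂, hne, hu₁, hu₂, hq₁, hq₂⟩ := exists_two_of_le_length_filter hgap
    simp only [decide_eq_true_eq] at hq₁ hq₂
    obtain ⟨ho₁, hc₁, he₁⟩ := hq₁
    obtain ⟨ho₂, hc₂, he₂⟩ := hq₂
    have hp₁ := (hF.pairs_iff (potEdge l u₁)).2 ⟨u₁, hu₁, he₁, rfl⟩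
    have hp₂ := (hF.pairs_iff (potEdge l u₂)).2 ⟨u₂, hu₂, he₂, rfl⟩
    rw [eν] at hp₁ hp₂
    have := hGL.two_le_crossings hk1 (fun e => hne (potEdge_inj e))
      (hGL.mem_cpairs_of_real hp₁.1 hp₁.2) (hGL.mem_cpairs_of_real hp₂.1 hp₂.2)
      (hc₁ ▸ horiz_potEdge ho₁) (hc₂ ▸ horiz_potEdge ho₂)
    omega
  · rw [ne_eq, ← List.length_eq_zero_iff, length_stepsOf]; omega
  · -- length
    rw [length_stepsOf]
    have := hGL.length_le ((Finset.range cs.length).filter fun u' => cs.getD u' false = true) fun i hi1 hi => by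
      obtain ⟨hp, hreal⟩ := hGL.real_cpair hi1 hi
      rw [← eν] at hp
      obtain ⟨u', hu', he', hpe⟩ := (hF.pairs_iff _).1 ⟨hp, hreal⟩
      refine ⟨u', ?_, hpe⟩
      rw [Finset.mem_filter, Finset.mem_range]
      exact ⟨by rw [hcs_def, List.length_append, List.length_singleton]; exact hu', he'⟩
    rw [edgesN]; omega

/-! ### Injectivity of decoding -/

/-- A run that completes cannot be continued. [folklore] -/
theorem runT_cons_of_complete {u : ℕ} {σ : State} {e : Bool} (h : step l r0 u σ e = .complete)
    (ys : List Bool) : runT l r0 u σ (e :: ys) = none := by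
  simp only [runT, h]

/-- Two accepted traces choosing the same edges are equal (the shorter would complete the run
of the longer too early). [folklore] -/
theorem accepts_eq_of_agree_aux {cs₁ cs₂ : List Bool} (h₁ : Accepts l r0 cs₁) (h₂ : Accepts l r0 cs₂)
    (hle : cs₁.length ≤ cs₂.length)
    (hagree : ∀ u', (u' < cs₁.length ∧ cs₁.getD u' false = true) ↔ (u' < cs₂.length ∧ cs₂.getD u' false = true)) :
    cs₁ = cs₂ := by
  -- pointwise agreement on the common prefix
  have hpt : ∀ u' < cs₁.length, cs₁.getD u' false = cs₂.getD u' false := by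
    intro u' hu'
    rcases Bool.eq_false_or_eq_true (cs₁.getD u' false) with h | h
    · rw [h, ((hagree u').1 ⟨hu', h⟩).2]
    · rcases Bool.eq_false_or_eq_true (cs₂.getD u' false) with h' | h'
      · exact absurd ((hagree u').2 ⟨by omega, h'⟩).2 (by rw [h]; exact Bool.false_ne_true)
      · rw [h, h']
  have htake : cs₂.take cs₁.length = cs₁ := by
    apply List.ext_getElem?
    intro u'
    by_cases hu' : u' < cs₁.length
    · rw [List.getElem?_take_of_lt hu']
      have e1 : cs₁[u']? = some (cs₁.getD u' false) := by
        rw [List.getD_eq_getElem?_getD, List.getElem?_eq_getElem hu']; rfl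
      have e2 : cs₂[u']? = some (cs₂.getD u' false) := by
        rw [List.getD_eq_getElem?_getD, List.getElem?_eq_getElem (by omega)]; rfl
      rw [e1, e2, hpt u' hu']
    · rw [List.getElem?_eq_none (by simp; omega), List.getElem?_eq_none (by omega)]
  rcases hle.eq_or_lt with heq | hlt
  · rw [← htake, List.take_of_length_le (le_of_eq heq.symm)]
  · exfalso
    obtain ⟨init₁, e₁, σ₁, rfl, hrun₁, hstep₁⟩ := h₁
    obtain ⟨init₂, e₂, σ₂, hcs₂, hrun₂, -⟩ := h₂
    -- cs₂ = (init₁ ++ [e₁]) ++ D with D non-empty, so init₂ = init₁ ++ e₁ :: D.dropLast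
    set D := cs₂.drop (init₁ ++ [e₁]).length with hD
    have hcs₂' : cs₂ = (init₁ ++ [e₁]) ++ D := by rw [← htake, List.take_append_drop]
    have hDne : D ≠ [] := by
      intro h; rw [h, List.append_nil] at hcs₂'; rw [hcs₂'] at hlt; exact lt_irrefl _ hlt
    have hinit₂ : init₂ = init₁ ++ (e₁ :: D.dropLast) := by
      have := congrArg List.dropLast hcs₂
      rw [List.dropLast_concat] at this
      rw [← this, hcs₂', List.dropLast_append_of_ne_nil hDne]; simp
    rw [hinit₂, runT_append, hrun₁, Option.bind_some, zero_add, runT_cons_of_complete hstep₁] at hrun₂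
    exact absurd hrun₂ (by simp)

/-- **Decoding is injective on accepted traces.** [cite: Jensen2004SAWLowerBounds, §2.1] -/
theorem decode_inj (hl : 2 ≤ l) {cs₁ cs₂ : List Bool} (h₁ : Accepts l r0 cs₁) (h₂ : Accepts l r0 cs₂)
    (h : decode l r0 cs₁ = decode l r0 cs₂) : cs₁ = cs₂ := by
  -- reconstruct, for each trace, the final strand behind `decode`
  have key : ∀ cs, Accepts l r0 cs → ∃ ν, Final l r0 cs cs.length ν ∧ decode l r0 cs = stepsOf r0 ν.dropLast := by
    rintro _ ⟨init, e, σ, rfl, hrun, hstep⟩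
    have hG : ∃ S, runG l r0 0 (initState l) [] init = some (σ, S) := by
      have := runG_fst (l := l) (r0 := r0) 0 (initState l) [] init
      rw [hrun] at this
      cases hr : runG l r0 0 (initState l) [] init with
      | none => rw [hr] at this; simp at this
      | some p => rw [hr] at this; simp only [Option.map_some, Option.some.injEq] at this
                  exact ⟨p.2, by rw [← this]⟩
    obtain ⟨S, hrunG⟩ := hG
    have hI : Inv l r0 (init ++ [e]) init.length σ S := inv_runG hl init (fun u hu => by
      rw [List.getD_eq_getElem?_getD, List.getD_eq_getElem?_getD, List.getElem?_append_left hu]) hrunG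
    have he : (init ++ [e]).getD init.length false = e := by
      rw [List.getD_eq_getElem?_getD, List.getElem?_append_right le_rfl]; simp
    have hF := final_step hl hI (by rw [he]; exact hstep)
    refine ⟨_, by simpa using hF, ?_⟩
    rw [decode, List.dropLast_concat, hrunG]
    simp
  obtain ⟨ν₁, hF₁, hd₁⟩ := key cs₁ h₁
  obtain ⟨ν₂, hF₂, hd₂⟩ := key cs₂ h₂
  obtain ⟨eν₁, hG₁⟩ := hF₁.goodL
  obtain ⟨eν₂, hG₂⟩ := hF₂.goodL
  rw [hd₁, hd₂] at h
  -- the two vertex lists agree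
  have hlen : ν₁.dropLast.length = ν₂.dropLast.length := by
    have := congrArg List.length h
    rw [length_stepsOf, length_stepsOf] at this
    have := hG₁.two_le; have := hG₂.two_le; omega
  have hL : ν₁.dropLast = ν₂.dropLast := by
    apply List.ext_getElem hlen
    intro i hi₁ hi₂
    have e1 := hG₁.traj_stepsOf i hi₁
    have e2 := hG₂.traj_stepsOf i hi₂
    rw [h] at e1; rw [e1] at e2
    exact ptX_inj_of_ne (fun e => hG₁.notsnk (e ▸ List.getElem_mem _)) (fun e => hG₂.notsnk (e ▸ List.getElem_mem _)) e2
  have hν : ν₁ = ν₂ := by rw [eν₁, eν₂, hL]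
  subst hν
  -- hence the same chosen edges
  have hagree : ∀ u', (u' < cs₁.length ∧ cs₁.getD u' false = true) ↔ (u' < cs₂.length ∧ cs₂.getD u' false = true) := by
    intro u'
    have k1 := hF₁.pairs_iff (potEdge l u')
    have k2 := hF₂.pairs_iff (potEdge l u')
    rw [k1] at k2
    constructor
    · rintro ⟨hu, he⟩
      obtain ⟨u'', hu'', he'', hpe⟩ := k2.1 ⟨u', hu, he, rfl⟩
      rw [potEdge_inj hpe]; exact ⟨hu'', he''⟩
    · rintro ⟨hu, he⟩
      obtain ⟨u'', hu'', he'', hpe⟩ := k2.2 ⟨u', hu, he, rfl⟩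
      rw [potEdge_inj hpe]; exact ⟨hu'', he''⟩
  rcases le_total cs₁.length cs₂.length with hle | hle
  · exact accepts_eq_of_agree_aux h₁ h₂ hle hagree
  · exact (accepts_eq_of_agree_aux h₂ h₁ hle fun u' => (hagree u').symm).symm

end StripTM

end Literature.Probability.RandomPlanarGeometry.SAW
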